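import Summits.HodgeConjecture.HodgeConjecture.Theorems.F0P3SpectralPacketPresentationBridgeZero   -- (N) FILE 3u′ (this seat): ramified branches for pin-presented partners (+ ★ 3u, ★ 3u-H, ★ 3l, ★ 3p, ★ 3k–3o)
import Summits.HodgeConjecture.HodgeConjecture.Theorems.F0P3SpectralPacketHomogeneous                -- ★ (N) FILE 3w p844258: `HomogPacketG` (the tuple's `PG′`)
import Summits.HodgeConjecture.HodgeConjecture.Theorems.F0P3GHSideOfFibres                           -- ★ `ghOfFibres`
import Summits.HodgeConjecture.HodgeConjecture.Theorems.F0P3KitOfRecordLawsV8                        -- ★ v8 `ClassificationKit.FactorisationPk 𝔠 S₀`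
import HarnessLib

/-!
# (N) DEFS, FILE 3x — CLAUSE (P1) `FactorisationPk` OF LETTER K9-STF BY NAME AT THE HOMOGENEOUS COHERENT TUPLE, FROM THE PINS' TENSOR WITNESSES
# (Rogawski §13.2; §13.7 p. 206; §14.2 (14.2.1) pp. 232–233; §14.3 p. 233; §14.6 p. 243; FlathCorvallis1979 Thm. 3; CartierCorvallis1979 §IV)

Cell `hodgecm-mathlib` (D-0151), F0∕P3 «U3-mult», crux H413 (`stmt-HodgeConjecture-24833`), route of record `HCCMUnconditional`.  (N) lead pen F0P3a-p01 (g13); desk F0P3-plan (g9) D33 (7) GATE 1′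
(«(P1) CLOSED BY NAME before the Defs ED. 3 cut»); LEAD F0P3a-plan (g10) T9-35 (hP1 BY NAME).  PROOF LANE: one theorem, 0 definitions, no instance, no notation, no named fact, no `sorry`;
`--supports stmt-HodgeConjecture-24833 --as helper`.  Never imports a `Cruxes/…/Lines` module: the pins (ix′)∕(xi″-c) enter as the HYPOTHESES `htens`∕`htensH` (their `∃ T`-shape verbatim, read at
the record tensor `tens₀ S fS fT`), which the junction discharges by `IsPinned.transfer_tensors` ∕ `IsPinned.deltaTransfer` + ★ `matches_tensG_tensH` + ★ `coe_tens₀`.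
HONEST LABEL: HC_CM is proved only modulo the printed citations until rung 0 closes; this file proves no printed statement.

THE THEOREM `SpectralPacketG.factorisationPk_kitOfRecord_hom` — conclusion LITERALLY `FactorisationPk (kitOfRecord L H ι T hT μGp 𝔰 (ghOfFibres ι T hT 𝔰 hg hsm trGS trHS) ξd μω c jInf dsInf archTr νA νG ramCls₀) S₀`
at the socket `𝔰 := ⟨traceGp, Smooth, HomogPacketG 𝔩 𝔞 μ infOf aTok, SpectralPacketH 𝔩 𝔞 𝔞H DiscH, nG, nH, (fun Q => Q.1.tr νsplit archTrG), (fun ρ => ρ.trH νH archTrH), Matches⟩` with the (N) slots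
`trGS S Q fS := Q.1.trSψ ψ S νsplit archTr fS`, `trHS S ρ fS := ρ.trHSψ ψ S νsplit archTr fS`, a ξ-side `ξd` whose `evpG∕evpH∕ramG∕ramH` read `evpGψ∕evpHψ∕ramFinset∕ramFinsetH` (`hξ·`, `rfl` at 𝔎₀), from:
the pins' tensor witnesses `htens`∕`htensH`; the kit laws (ℓ4) (ℓ9) (TF-1) (TF-1)-H (TF-ind), member admissibility (both groups), the Gelfand bound off `S₀`, `ψ_v(K′_v) = K_v` off `S₀`; the GUARDED
transfer laws (m3) `InnerTransferLawTest`, (o1) `CharIdentityψ`, (o6) `EndoTransferLawTest`; homogeneity of `archTr`, `archTrH`; and the HAAR NORMALISATION **`hvol : ∀ v, (νG v).real K′_v = 1`**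
(n-vol: the local traces at `supp f^S` produce `vol_{νG v}(K′_v) · t_v(f^S_v)` — ★ 3j — while `hat₀` is the bare Satake product; print normalises `vol(K_v) = 1`, §4.3 p. 44, §5.4 p. 72; the closer's
`Rung0Witness.hPH : IsProductHaar …` supplies it).  Proof: four branches — ★ 3u (u5) ∕ 3u′ (z1) on `G`, ★ 3u-H (uH5) ∕ 3u′ (z2) on `H` — and `hat₀ S (germ t) fT = ∏_{v ∈ supp f^S} t_v(f^S_v)` (★ `hat₀_germ`).

References: [Rogawski1990] §13.2 pp. 199–200; §13.7 p. 206; §14.2 (14.2.1) pp. 232–233; §14.3 p. 233; §14.4 Prop. 14.4.1 (c), 14.4.2 pp. 235–236; §14.6 p. 243 l. 9–17; §4.3 p. 44; §5.4 p. 72.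
[FlathCorvallis1979] Thm. 3.  [CartierCorvallis1979] §IV.1 Cor. 4.1.
-/

set_option autoImplicit false
-- the mandated namespace repeats `HodgeConjecture.HodgeConjecture`, as in every `Theorems/*.lean` of this sub-problem
set_option linter.dupNamespace false

noncomputable section

open NumberField IsDedekindDomain MeasureTheory
open scoped Matrix MatrixGroups

open Literature.NumberTheory Literature.NumberTheory.Automorphic Literature.NumberTheory.Automorphic.UnitaryGroup
open Literature.NumberTheory.Rogawski1990 Literature.NumberTheory.GaloisRepresentations
open Literature.RepresentationTheory.BorelWallach2000 Literature.RepresentationTheory.KonnoKonno2007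
open Summit.HodgeConjecture.HodgeConjecture.Cruxes.H413.F0P3InnerFormClassificationV6
open Summit.HodgeConjecture.HodgeConjecture.Cruxes.H413.F0P3LocalPacketKit
open Summit.HodgeConjecture.HodgeConjecture.Cruxes.H413.F0P3ArchPacketKit
open Summit.HodgeConjecture.HodgeConjecture.Cruxes.H413.F0P3SemilocalTestFunctionsOfRecord (TestS₀ tens₀ toPureTensor coe_tens₀)
open Summit.HodgeConjecture.HodgeConjecture.Cruxes.H413.F0P3TestFunctionsOfRecord (Unr₀ hat₀)
open Summit.HodgeConjecture.HodgeConjecture.Cruxes.H413.F0P3UnrTensorInstance (UnrTensor)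
open Summit.HodgeConjecture.HodgeConjecture.Cruxes.H413.F0P3KitOfRecord (GHSide XiSide kitOfRecord)
open Summit.HodgeConjecture.HodgeConjecture.Cruxes.H413.F0P3GHSideOfFibres (ghOfFibres matches_tensG_tensH)

namespace Summit.HodgeConjecture.HodgeConjecture.Cruxes.H413.F0P3SpectralPacket.SpectralPacketG

open Summit.HodgeConjecture.HodgeConjecture.Cruxes.H413.F0P3GlobalPacket
open Summit.HodgeConjecture.HodgeConjecture.Cruxes.H413.F0P3ArchPacketKit.ArchPacketKitH

variable {L : Type} [Field L] [NumberField L] [IsCMField L] {H : Matrix (Fin 3) (Fin 3) L}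
  -- the frame, T1's sockets other than the packet types, and `kitOfRecord`'s remaining parameters
  (ι : L →+* ℂ) (T : GL (Fin 3) ℂ)
  (hT : (T : Matrix (Fin 3) (Fin 3) ℂ)ᴴ * H.map ι * (T : Matrix (Fin 3) (Fin 3) ℂ) = Literature.Geometry.ComplexHyperbolic.BallModel.J)
  (μGp : Measure (Gp L H).automorphicQuotient) [(Gp L H).IsAutomorphicMeasure μGp]
  (traceGp : TestGp L H →ₗ[ℂ] ℂ) (Smooth : TestGp L H → Prop) (Matches : TestGp L H → TestG L → TestH L → Prop)
  (μω : HeckeCharacter L) (c : ℚ) (jInf dsInf : ℤ → ℤ → ℤ → Cinf)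
  (archTr : Cinf → (UnitaryGroup.arch (↥(maximalRealSubfield L)) L (IsCMField.complexConj L) 3 H → ℂ) → ℂ)
  -- the adelic Haar measure in the LETTER's typing (`borel`-based, instances re-introduced by `letI` as in `K9SpectralLetterSigned` — so the conclusion matches the letter's clause up to `rfl`)
  (νA : @Measure (Gp L H).Adelic (borel _)) (hνA : letI : MeasurableSpace (Gp L H).Adelic := borel _; IsFiniteMeasureOnCompacts νA)
  (νG : ∀ v : Places L, @Measure ((cmDatum L 3 H).Local v) (borel _))
  (ramCls₀ : DiscreteAutomorphicRep (Gp L H) μGp → Set (Places L))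
  -- the (N) kits and slots
  {𝔩 : ∀ v : HeightOneSpectrum (𝓞 ↥(maximalRealSubfield L)), LocalPacketKit L (splitForm L 3) v} {𝔞 : ArchPacketKit} {𝔞H : ArchPacketKitH 𝔞}
  {DiscH : GlobalPacketH 𝔩 → 𝔞H.PktInfH → Prop}
  {μ : Measure (adelicGroupData (↥(maximalRealSubfield L)) L (IsCMField.complexConj L) 3 (splitForm L 3)).automorphicQuotient}
  [SMulInvariantMeasure (adelicGroupData (↥(maximalRealSubfield L)) L (IsCMField.complexConj L) 3 (splitForm L 3)).Adelic
    (adelicGroupData (↥(maximalRealSubfield L)) L (IsCMField.complexConj L) 3 (splitForm L 3)).automorphicQuotient μ]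
  [∀ v : HeightOneSpectrum (𝓞 ↥(maximalRealSubfield L)), MeasurableSpace ((cmDatum L 3 (splitForm L 3)).Local v)]
  [∀ v : HeightOneSpectrum (𝓞 ↥(maximalRealSubfield L)), BorelSpace ((cmDatum L 3 (splitForm L 3)).Local v)]
  [∀ v : HeightOneSpectrum (𝓞 ↥(maximalRealSubfield L)), MeasurableSpace ((cmDatum L 2 (splitForm L 2)).Local v × (cmDatum L 1 (splitForm L 1)).Local v)]
  [∀ v : HeightOneSpectrum (𝓞 ↥(maximalRealSubfield L)), BorelSpace ((cmDatum L 2 (splitForm L 2)).Local v × (cmDatum L 1 (splitForm L 1)).Local v)]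
  (infOf : GlobalPacket 𝔩 → 𝔞.PktInf) (aTok : ∀ v : HeightOneSpectrum (𝓞 ↥(maximalRealSubfield L)), Set (𝔩 v).Pkt)
  (nG : HomogPacketG 𝔩 𝔞 μ infOf aTok → ℂ) (nH : SpectralPacketH 𝔩 𝔞 𝔞H DiscH → ℂ)
  (ξd : XiSide L H (HomogPacketG 𝔩 𝔞 μ infOf aTok) (SpectralPacketH 𝔩 𝔞 𝔞H DiscH))
  (νH : ∀ v : HeightOneSpectrum (𝓞 ↥(maximalRealSubfield L)), Measure ((cmDatum L 2 (splitForm L 2)).Local v × (cmDatum L 1 (splitForm L 1)).Local v))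
  [∀ v, (νH v).IsMulLeftInvariant] [∀ v, IsFiniteMeasureOnCompacts (νH v)]
  (archTrG : Cinf → (UnitaryGroup.arch (↥(maximalRealSubfield L)) L (IsCMField.complexConj L) 3 (splitForm L 3) → ℂ) → ℂ)
  (archTrH : 𝔞H.CinfH → (UnitaryGroup.arch (↥(maximalRealSubfield L)) L (IsCMField.complexConj L) 2 (splitForm L 2) × UnitaryGroup.arch (↥(maximalRealSubfield L)) L (IsCMField.complexConj L) 1 (splitForm L 1) → ℂ) → ℂ)

/-- **(P1) `FactorisationPk` OF LETTER K9-STF AT THE HOMOGENEOUS COHERENT TUPLE, BY NAME** — «`Tr Q(f) = Tr Q_S(f′_S) · f^{S∧}(t(Q))` at the T1g-chosen partner of `f′_{S,∞} ⊗ f^S`, and `0` if `ramG Q ⊄ S`»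
on both groups [FlathCorvallis1979 Thm. 3; CartierCorvallis1979 §IV; Rogawski1990 §13.2, §13.7 p. 206, (14.2.1) p. 232, §14.3, §14.6 p. 243], for the letter's own `kitOfRecord … (ghOfFibres …) ξd …`
with the (N) slots, from the pins' tensor witnesses (`htens`, `htensH`), the kit laws, the GUARDED transfer laws (m3)(o1)(o6), homogeneity of the archimedean characters, and the Haar
normalisation `hvol` («`vol(K′_v) = 1`», §4.3 p. 44). [cite: FlathCorvallis1979, Thm. 3] [cite: CartierCorvallis1979, §IV.1 Cor. 4.1] [cite: Rogawski1990, §13.7 p. 206; §14.2 (14.2.1) pp. 232–233; §14.3 p. 233; §14.6 p. 243 l. 9–17; §4.3 p. 44] -/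
theorem factorisationPk_kitOfRecord_hom
    (ψ : ∀ v : HeightOneSpectrum (𝓞 ↥(maximalRealSubfield L)), (cmDatum L 3 H).Local v ≃ₜ* (cmDatum L 3 (splitForm L 3)).Local v)
    (hνl : ∀ v : HeightOneSpectrum (𝓞 ↥(maximalRealSubfield L)), letI : ∀ v : HeightOneSpectrum (𝓞 ↥(maximalRealSubfield L)), MeasurableSpace ((cmDatum L 3 H).Local v) := fun _ => borel _; (νG v).IsMulLeftInvariant)
    (hνc : ∀ v : HeightOneSpectrum (𝓞 ↥(maximalRealSubfield L)), letI : ∀ v : HeightOneSpectrum (𝓞 ↥(maximalRealSubfield L)), MeasurableSpace ((cmDatum L 3 H).Local v) := fun _ => borel _; IsFiniteMeasureOnCompacts (νG v))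
    -- kit laws
    (h1 : ∀ Pg : GlobalPacket 𝔩, Pg.UnramTraceOne (fun v => @Measure.map _ _ (borel _) _ (ψ v) (νG v)))
    (hind : ∀ Q : SpectralPacketG 𝔩 𝔞 μ, Q.PresentationIndep (fun v => @Measure.map _ _ (borel _) _ (ψ v) (νG v)) archTrG)
    (h4 : ∀ v : HeightOneSpectrum (𝓞 ↥(maximalRealSubfield L)), (𝔩 v).UnramLaw)
    (hU : ∀ v : HeightOneSpectrum (𝓞 ↥(maximalRealSubfield L)), UnrDefLaw (𝔩 v))
    (hadm : ∀ (v : HeightOneSpectrum (𝓞 ↥(maximalRealSubfield L))) (P : (𝔩 v).Pkt), ∀ π ∈ (𝔩 v).mem P, π.IsAdmissible)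
    (hadmH : ∀ (v : HeightOneSpectrum (𝓞 ↥(maximalRealSubfield L))) (ρ : (𝔩 v).PktH), ∀ σ ∈ (𝔩 v).memH ρ, σ.IsAdmissible)
    (h1H : ∀ ρ : SpectralPacketH 𝔩 𝔞 𝔞H DiscH, ρ.UnramTraceOneH νH)
    (S₀ : Finset (HeightOneSpectrum (𝓞 ↥(maximalRealSubfield L))))
    (hgood : ∀ v ∉ S₀, ∀ r : SmoothIrrep ((UnitaryGroup.cmDatum L 3 (splitForm L 3)).Local v), r.ρ.IsAdmissible →
      Module.finrank ℂ (r.ρ.fixedPoints (cmLocalIntegralLevel L 3 (splitForm L 3) v)) ≤ 1)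
    (hψK : ∀ v ∉ S₀, (cmLocalIntegralLevel L 3 H v).map (ψ v : (cmDatum L 3 H).Local v →* (cmDatum L 3 (splitForm L 3)).Local v) =
      cmLocalIntegralLevel L 3 (splitForm L 3) v)
    (hvol : ∀ v : HeightOneSpectrum (𝓞 ↥(maximalRealSubfield L)), (νG v).real (cmLocalIntegralLevel L 3 H v : Set ((cmDatum L 3 H).Local v)) = 1)
    -- homogeneity of the archimedean characters
    (harch' : ∀ (a : Cinf) (k : ℂ) (f : UnitaryGroup.arch (↥(maximalRealSubfield L)) L (IsCMField.complexConj L) 3 H → ℂ), archTr a (k • f) = k * archTr a f)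
    (harchH : ∀ (a : 𝔞H.CinfH) (k : ℂ) (f : UnitaryGroup.arch (↥(maximalRealSubfield L)) L (IsCMField.complexConj L) 2 (splitForm L 2) × UnitaryGroup.arch (↥(maximalRealSubfield L)) L (IsCMField.complexConj L) 1 (splitForm L 1) → ℂ), archTrH a (k • f) = k * archTrH a f)
    -- the GUARDED transfer laws (m3) (o1) (o6) at the pin's orbital families
    (m' : letI : ∀ γ : UnitaryGroup.arch (↥(maximalRealSubfield L)) L (IsCMField.complexConj L) 3 H,
        MeasurableSpace (UnitaryGroup.arch (↥(maximalRealSubfield L)) L (IsCMField.complexConj L) 3 H ⧸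
          Subgroup.centralizer ({γ} : Set (UnitaryGroup.arch (↥(maximalRealSubfield L)) L (IsCMField.complexConj L) 3 H))) := fun _ => borel _;
      OrbitalMeasureFamily (UnitaryGroup.arch (↥(maximalRealSubfield L)) L (IsCMField.complexConj L) 3 H))
    (m : letI : ∀ γ : UnitaryGroup.arch (↥(maximalRealSubfield L)) L (IsCMField.complexConj L) 3 (splitForm L 3),
        MeasurableSpace (UnitaryGroup.arch (↥(maximalRealSubfield L)) L (IsCMField.complexConj L) 3 (splitForm L 3) ⧸
          Subgroup.centralizer ({γ} : Set (UnitaryGroup.arch (↥(maximalRealSubfield L)) L (IsCMField.complexConj L) 3 (splitForm L 3)))) := fun _ => borel _;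
      OrbitalMeasureFamily (UnitaryGroup.arch (↥(maximalRealSubfield L)) L (IsCMField.complexConj L) 3 (splitForm L 3)))
    (hlaw : 𝔞.InnerTransferLawTest L H m' m archTrG archTr)
    {Δ' : ∀ v : HeightOneSpectrum (𝓞 ↥(maximalRealSubfield L)), LocalTransferFactor L H v}
    (mH : letI : ∀ (v : HeightOneSpectrum (𝓞 ↥(maximalRealSubfield L))) (a : (cmDatum L 2 (splitForm L 2)).Local v × (cmDatum L 1 (splitForm L 1)).Local v), MeasurableSpace (((cmDatum L 2 (splitForm L 2)).Local v × (cmDatum L 1 (splitForm L 1)).Local v) ⧸ Subgroup.centralizer ({a} : Set ((cmDatum L 2 (splitForm L 2)).Local v × (cmDatum L 1 (splitForm L 1)).Local v))) := fun _ _ => borel _;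
      ∀ v : HeightOneSpectrum (𝓞 ↥(maximalRealSubfield L)), OrbitalMeasureFamily ((cmDatum L 2 (splitForm L 2)).Local v × (cmDatum L 1 (splitForm L 1)).Local v))
    (mG' : letI : ∀ (v : HeightOneSpectrum (𝓞 ↥(maximalRealSubfield L))) (γ : (cmDatum L 3 H).Local v), MeasurableSpace ((cmDatum L 3 H).Local v ⧸ Subgroup.centralizer ({γ} : Set ((cmDatum L 3 H).Local v))) := fun _ _ => borel _;
      ∀ v : HeightOneSpectrum (𝓞 ↥(maximalRealSubfield L)), OrbitalMeasureFamily ((cmDatum L 3 H).Local v))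
    (hlawψ : letI : ∀ v : HeightOneSpectrum (𝓞 ↥(maximalRealSubfield L)), MeasurableSpace ((cmDatum L 3 H).Local v) := fun _ => borel _; ∀ ρ : SpectralPacketH 𝔩 𝔞 𝔞H DiscH, ρ.CharIdentityψ ψ νG νH Δ' mH mG')
    {Tinf : ArchTransferFactor L H}
    (mHi : letI : ∀ a : UnitaryGroup.arch (↥(maximalRealSubfield L)) L (IsCMField.complexConj L) 2 (splitForm L 2) × UnitaryGroup.arch (↥(maximalRealSubfield L)) L (IsCMField.complexConj L) 1 (splitForm L 1), MeasurableSpace ((UnitaryGroup.arch (↥(maximalRealSubfield L)) L (IsCMField.complexConj L) 2 (splitForm L 2) × UnitaryGroup.arch (↥(maximalRealSubfield L)) L (IsCMField.complexConj L) 1 (splitForm L 1)) ⧸ Subgroup.centralizer ({a} : Set (UnitaryGroup.arch (↥(maximalRealSubfield L)) L (IsCMField.complexConj L) 2 (splitForm L 2) × UnitaryGroup.arch (↥(maximalRealSubfield L)) L (IsCMField.complexConj L) 1 (splitForm L 1)))) := fun _ => borel _;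
      OrbitalMeasureFamily (UnitaryGroup.arch (↥(maximalRealSubfield L)) L (IsCMField.complexConj L) 2 (splitForm L 2) × UnitaryGroup.arch (↥(maximalRealSubfield L)) L (IsCMField.complexConj L) 1 (splitForm L 1)))
    (hlawInf : 𝔞H.EndoTransferLawTest L H Tinf mHi m' archTrH archTr)
    -- the letter's socket-level `hg`∕`hsm`, and the ξ-side read-backs
    (hg : ∀ f' : TestGp L H, Smooth f' → ∃ (f : TestG L) (fH : TestH L), Matches f' f fH)
    (hsm : ∀ (S : Finset (Places L)) (fS : TestS₀ L H ι T hT S) (fT : Unr₀ L H S), Smooth (tens₀ S fS fT))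
    (hξG : ∀ Q, ξd.evpG Q = Q.1.evpGψ ψ (fun v => @Measure.map _ _ (borel _) _ (ψ v) (νG v))) (hξH : ∀ ρ, ξd.evpH ρ = ρ.evpHψ ψ (fun v => @Measure.map _ _ (borel _) _ (ψ v) (νG v)))
    (hξrG : ∀ Q, ξd.ramG Q = Q.1.fin.ramFinset) (hξrH : ∀ ρ, ξd.ramH ρ = ρ.ramFinsetH)
    -- the pins' tensor witnesses at the record tensors (pin (ix′) `transfer_tensors`, pin (xi″-c) `deltaTransfer`, read through ★ `matches_tensG_tensH` + ★ `coe_tens₀`)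
    (htens : ∀ (S : Finset (Places L)) (fS : TestS₀ L H ι T hT S) (fT : Unr₀ L H S),
      ∃ (T₁ : UnitaryGroup.PureTensor L 3 H) (T' : UnitaryGroup.PureTensor L 3 (splitForm L 3)),
        T₁.IsTest ∧ T'.IsTest ∧ T₁.eval = (toPureTensor S fS fT).eval ∧
        ⇑((ghOfFibres ι T hT (⟨traceGp, Smooth, HomogPacketG 𝔩 𝔞 μ infOf aTok, SpectralPacketH 𝔩 𝔞 𝔞H DiscH, nG, nH,
            (fun Q => Q.1.tr (fun v => @Measure.map _ _ (borel _) _ (ψ v) (νG v)) archTrG), (fun ρ => ρ.trH νH archTrH), Matches⟩ : Sockets L H μGp) hg hsm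
            (fun S Q fS => Q.1.trSψ ψ S (fun v => @Measure.map _ _ (borel _) _ (ψ v) (νG v)) archTr fS) (fun S ρ fS => ρ.trHSψ ψ S (fun v => @Measure.map _ _ (borel _) _ (ψ v) (νG v)) archTr fS)).tensG S fS fT) = T'.eval ∧
        (∀ v, T'.loc v = T₁.loc v ∘ (ψ v).symm) ∧
        (letI : ∀ γ : UnitaryGroup.arch (↥(maximalRealSubfield L)) L (IsCMField.complexConj L) 3 H,
        MeasurableSpace (UnitaryGroup.arch (↥(maximalRealSubfield L)) L (IsCMField.complexConj L) 3 H ⧸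
          Subgroup.centralizer ({γ} : Set (UnitaryGroup.arch (↥(maximalRealSubfield L)) L (IsCMField.complexConj L) 3 H))) := fun _ => borel _
         letI : ∀ γ : UnitaryGroup.arch (↥(maximalRealSubfield L)) L (IsCMField.complexConj L) 3 (splitForm L 3),
        MeasurableSpace (UnitaryGroup.arch (↥(maximalRealSubfield L)) L (IsCMField.complexConj L) 3 (splitForm L 3) ⧸
          Subgroup.centralizer ({γ} : Set (UnitaryGroup.arch (↥(maximalRealSubfield L)) L (IsCMField.complexConj L) 3 (splitForm L 3)))) := fun _ => borel _
         IsArchInnerTransfer L H m' m T₁.arch T'.arch))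
    (htensH : ∀ (S : Finset (Places L)) (fS : TestS₀ L H ι T hT S) (fT : Unr₀ L H S),
      ∃ (T₁ : UnitaryGroup.PureTensor L 3 H) (TH : UnitaryGroup.PureTensor₂ L (splitForm L 2) (splitForm L 1)),
        T₁.IsTest ∧ TH.IsUnramified₂ ∧ (∀ v, IsLocSmooth (TH.loc v)) ∧ ArchSmooth₂ L TH.arch ∧ T₁.eval = (toPureTensor S fS fT).eval ∧
        ⇑((ghOfFibres ι T hT (⟨traceGp, Smooth, HomogPacketG 𝔩 𝔞 μ infOf aTok, SpectralPacketH 𝔩 𝔞 𝔞H DiscH, nG, nH,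
            (fun Q => Q.1.tr (fun v => @Measure.map _ _ (borel _) _ (ψ v) (νG v)) archTrG), (fun ρ => ρ.trH νH archTrH), Matches⟩ : Sockets L H μGp) hg hsm
            (fun S Q fS => Q.1.trSψ ψ S (fun v => @Measure.map _ _ (borel _) _ (ψ v) (νG v)) archTr fS) (fun S ρ fS => ρ.trHSψ ψ S (fun v => @Measure.map _ _ (borel _) _ (ψ v) (νG v)) archTr fS)).tensH S fS fT) = TH.eval ∧
        (letI : ∀ (v : HeightOneSpectrum (𝓞 ↥(maximalRealSubfield L))) (a : (cmDatum L 2 (splitForm L 2)).Local v × (cmDatum L 1 (splitForm L 1)).Local v), MeasurableSpace (((cmDatum L 2 (splitForm L 2)).Local v × (cmDatum L 1 (splitForm L 1)).Local v) ⧸ Subgroup.centralizer ({a} : Set ((cmDatum L 2 (splitForm L 2)).Local v × (cmDatum L 1 (splitForm L 1)).Local v))) := fun _ _ => borel _;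
         letI : ∀ (v : HeightOneSpectrum (𝓞 ↥(maximalRealSubfield L))) (γ : (cmDatum L 3 H).Local v), MeasurableSpace ((cmDatum L 3 H).Local v ⧸ Subgroup.centralizer ({γ} : Set ((cmDatum L 3 H).Local v))) := fun _ _ => borel _;
         ∀ v, IsLocalDeltaTransfer L H v (Δ' v) (mH v) (mG' v) (TH.loc v) (T₁.loc v)) ∧
        (letI : ∀ a : UnitaryGroup.arch (↥(maximalRealSubfield L)) L (IsCMField.complexConj L) 2 (splitForm L 2) × UnitaryGroup.arch (↥(maximalRealSubfield L)) L (IsCMField.complexConj L) 1 (splitForm L 1), MeasurableSpace ((UnitaryGroup.arch (↥(maximalRealSubfield L)) L (IsCMField.complexConj L) 2 (splitForm L 2) × UnitaryGroup.arch (↥(maximalRealSubfield L)) L (IsCMField.complexConj L) 1 (splitForm L 1)) ⧸ Subgroup.centralizer ({a} : Set (UnitaryGroup.arch (↥(maximalRealSubfield L)) L (IsCMField.complexConj L) 2 (splitForm L 2) × UnitaryGroup.arch (↥(maximalRealSubfield L)) L (IsCMField.complexConj L) 1 (splitForm L 1)))) := fun _ => borel _;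
         letI : ∀ γ : UnitaryGroup.arch (↥(maximalRealSubfield L)) L (IsCMField.complexConj L) 3 H,
        MeasurableSpace (UnitaryGroup.arch (↥(maximalRealSubfield L)) L (IsCMField.complexConj L) 3 H ⧸
          Subgroup.centralizer ({γ} : Set (UnitaryGroup.arch (↥(maximalRealSubfield L)) L (IsCMField.complexConj L) 3 H))) := fun _ => borel _;
         IsArchDeltaTransfer L H Tinf mHi m' TH.arch T₁.arch)) :
    letI : MeasurableSpace (Gp L H).Adelic := borel _
    haveI : BorelSpace (Gp L H).Adelic := ⟨rfl⟩
    haveI : IsFiniteMeasureOnCompacts νA := hνA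
    F0P3InnerFormClassificationV8.ClassificationKit.FactorisationPk
      (kitOfRecord L H ι T hT μGp
        (⟨traceGp, Smooth, HomogPacketG 𝔩 𝔞 μ infOf aTok, SpectralPacketH 𝔩 𝔞 𝔞H DiscH, nG, nH,
          (fun Q => Q.1.tr (fun v => @Measure.map _ _ (borel _) _ (ψ v) (νG v)) archTrG), (fun ρ => ρ.trH νH archTrH), Matches⟩ : Sockets L H μGp)
        (ghOfFibres ι T hT (⟨traceGp, Smooth, HomogPacketG 𝔩 𝔞 μ infOf aTok, SpectralPacketH 𝔩 𝔞 𝔞H DiscH, nG, nH,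
            (fun Q => Q.1.tr (fun v => @Measure.map _ _ (borel _) _ (ψ v) (νG v)) archTrG), (fun ρ => ρ.trH νH archTrH), Matches⟩ : Sockets L H μGp) hg hsm
          (fun S Q fS => Q.1.trSψ ψ S (fun v => @Measure.map _ _ (borel _) _ (ψ v) (νG v)) archTr fS) (fun S ρ fS => ρ.trHSψ ψ S (fun v => @Measure.map _ _ (borel _) _ (ψ v) (νG v)) archTr fS))
        ξd μω c jInf dsInf archTr νA νG ramCls₀) S₀ := by
  letI : MeasurableSpace (Gp L H).Adelic := borel _
  haveI : BorelSpace (Gp L H).Adelic := ⟨rfl⟩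
  haveI : IsFiniteMeasureOnCompacts νA := hνA
  letI : ∀ v : HeightOneSpectrum (𝓞 ↥(maximalRealSubfield L)), MeasurableSpace ((cmDatum L 3 H).Local v) := fun _ => borel _
  haveI : ∀ v : HeightOneSpectrum (𝓞 ↥(maximalRealSubfield L)), BorelSpace ((cmDatum L 3 H).Local v) := fun _ => ⟨rfl⟩
  haveI : ∀ v : HeightOneSpectrum (𝓞 ↥(maximalRealSubfield L)), (νG v).IsMulLeftInvariant := hνl
  haveI : ∀ v : HeightOneSpectrum (𝓞 ↥(maximalRealSubfield L)), IsFiniteMeasureOnCompacts (νG v) := hνc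
  have hμK : ∀ v : HeightOneSpectrum (𝓞 ↥(maximalRealSubfield L)), (νG v).real (cmLocalIntegralLevel L 3 H v : Set ((cmDatum L 3 H).Local v)) ≠ 0 :=
    fun v => by rw [hvol v]; exact one_ne_zero
  -- `hat₀ S (germ t) fT = ∏_{v ∈ supp f^S} t_v(f^S_v)` and `vol(K′_v) = 1`
  have hhat : ∀ (S : Finset (Places L)) (t : EvpData L H) (fT : Unr₀ L H S),
      hat₀ L H S (germ L H S t) fT = ∏ v ∈ fT.T, (((νG v).real (cmLocalIntegralLevel L 3 H v : Set ((cmDatum L 3 H).Local v)) : ℂ) * t v (fT.loc v)) := by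
    intro S t fT
    -- `germ` here is ★ V6's spelling of ★ V5's `germ` (definitionally the same quotient map), so ★ `hat₀_germ` is used through `rfl`
    have h0 : hat₀ L H S (germ L H S t) fT = UnrTensor.hatOf t fT := rfl
    rw [h0, F0P3UnrTensorInstance.UnrTensor.hatOf_def]
    exact Finset.prod_congr rfl fun v _ => by rw [hvol v, Complex.ofReal_one, one_mul]
  refine ⟨fun S Q fS fT hS₀ => ⟨fun hram => ?_, fun hram => ?_⟩, fun S ρ fS fT hS₀ => ⟨fun hram => ?_, fun hram => ?_⟩⟩
  · -- (P1)-G, unramified branch: ★ 3u (u5) at the pin's `(T₁, T′)`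
    obtain ⟨T₁, T', hT₁, hT', hTe, hF, hloc, harch⟩ := htens S fS fT
    have hramG : Q.1.fin.ramFinset ⊆ S := by rw [← hξrG]; exact hram
    have key := Q.1.tr_partner_eq_trSψ_mul_prod_of_eval_eq ψ (h1 Q.1.fin) (hind Q.1) h4 (fun v => hadm v _) S₀ hgood hψK hμK S hS₀ hramG fS fT
      hT₁ hTe hT' hloc hF archTr harch' m' m hlaw harch
    refine key.trans ?_
    change _ = Q.1.trSψ ψ S (fun v => @Measure.map _ _ (borel _) _ (ψ v) (νG v)) archTr fS * hat₀ L H S (germ L H S (ξd.evpG Q)) fT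
    rw [hξG, hhat]
  · -- (P1)-G, ramified branch: 3u′ (z1)
    obtain ⟨T₁, T', hT₁, hT', hTe, hF, hloc, harch⟩ := htens S fS fT
    have hramG : ¬ Q.1.fin.ramFinset ⊆ S := by rw [← hξrG]; exact hram
    exact Q.1.tr_partner_eq_zero_of_not_ramFinset_subset_of_eval_eq ψ (h1 Q.1.fin) (hind Q.1) hU (fun v => hadm v _) S₀ hgood hψK S hS₀ hramG fS fT
      hT₁ hTe hT' hloc hF archTr harch' m' m hlaw harch
  · -- (P1)-H, unramified branch: ★ 3u-H (uH5) at the pin's `(T₁, T^H)`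
    obtain ⟨T₁, TH, hT₁, hTH, hsH, haH, hTe, hFH, hΔ, harchΔ⟩ := htensH S fS fT
    have hramH : ρ.ramFinsetH ⊆ S := by rw [← hξrH]; exact hram
    have key := ρ.trH_partner_eq_trHSψ_mul_prod_of_eval_eq ψ (h1H ρ) (fun v => hadmH v _) harchH (h1 ρ.imageG) h4 (fun v => hadm v _) S₀ hgood hψK hμK S hS₀ hramH
      fS fT hTH hsH haH hFH hT₁ hTe archTr harch' (hlawψ ρ) hΔ hlawInf harchΔ
    refine key.trans ?_
    change _ = ρ.trHSψ ψ S (fun v => @Measure.map _ _ (borel _) _ (ψ v) (νG v)) archTr fS * hat₀ L H S (germ L H S (ξd.evpH ρ)) fT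
    rw [hξH, hhat]
  · -- (P1)-H, ramified branch: 3u′ (z2)
    obtain ⟨T₁, TH, hT₁, hTH, hsH, haH, hTe, hFH, hΔ, harchΔ⟩ := htensH S fS fT
    have hramH : ¬ ρ.ramFinsetH ⊆ S := by rw [← hξrH]; exact hram
    exact ρ.trH_partner_eq_zero_of_not_ramFinsetH_subset_of_eval_eq ψ (h1H ρ) (fun v => hadmH v _) harchH hU (fun v => hadm v _) S₀ hgood hψK S hS₀ hramH
      fS fT hTH hsH haH hFH hT₁ hTe archTr harch' (hlawψ ρ) hΔ hlawInf harchΔ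

end Summit.HodgeConjecture.HodgeConjecture.Cruxes.H413.F0P3SpectralPacket.SpectralPacketG

end
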